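import Summits.FinalStateConjecture.FinalStateConjecture.Theorems.EIHFluxBalanceInertialRecessionStubRechart3BoostTransport
import Summits.FinalStateConjecture.FinalStateConjecture.Theorems.EIHFluxBalanceInertialRecessionStubRechart3HoleLimit

/-!
# Route EIHFluxBalance — `InertialRecession`, re-charting: the truncated world-tubes of two holes separate

Helper file for the crux `stmt-FinalStateConjecture-10166`
(`Summit.FinalStateConjecture.FinalStateConjecture.Theses.EIHFluxBalance.InertialRecession`),
line `sublinear-is-free-clean-window-charges`, stub `stub_rechart` (the transfer P2), field
`exists_pairwise_disjoint` of the sought `FinalStateDecomposition`.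

`eventually_disjoint_truncLateRegion_images` — for two holes `i ≠ j` re-charted by maps `Aᵢ, Aⱼ`
with the clauses exported by `clockChart_package` (late lab times controlled by the clocks,
offsets `‖(A y)~ − ξ((A y)⁰)‖ ≤ P‖ỹ‖`), an injective-on-the-late-region lab chart `Φ`, and separating
centres `‖ξᵢ − ξⱼ‖ → ∞`: for every radius `R` the images of the truncated late regions
`{t* > τ₁, r ≤ R}` under the BOOSTED charts are disjoint for all late `τ₁` (a common point has ONE
lab time, at which both centres would be within `P(max R 0 + |a|)` of it). [folklore]
-/

noncomputable section

set_option linter.dupNamespace false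

open Set Filter Function Metric Topology TopologicalSpace
open scoped ContDiff Manifold ENNReal
open Literature.Geometry.Lorentzian

namespace Summit.FinalStateConjecture.FinalStateConjecture.Theorems.SublinearIsFree.Rechart

/-- Lab time of a chart point of the truncated late region is late: from `|(A y)⁰ − T₀(C y ⁰)| ≤ 4γ‖(C y)~‖`,
`‖(C y)~‖ ≤ ‖ỹ‖ ≤ K`, `y⁰ ≤ (C y)⁰`, `T₀` monotone. [folklore] -/
theorem labTime_ge_of_clauses {A C : E4 → E4} {T₀ : ℝ → ℝ} {γ K τ₁ : ℝ} (hmono : Monotone T₀)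
    (hwin : ∀ y, |A y 0 - T₀ (C y 0)| ≤ 4 * γ * ‖E4.spatial (C y)‖) (hCle : ∀ y, ‖E4.spatial (C y)‖ ≤ ‖E4.spatial y‖)
    (hC0 : ∀ y, y 0 ≤ C y 0) (hγ : 0 ≤ γ) {y : E4} (hy0 : τ₁ < y 0) (hyK : ‖E4.spatial y‖ ≤ K) :
    T₀ τ₁ - 4 * γ * K ≤ A y 0 := by
  have h1 := hwin y
  have h2 : T₀ τ₁ ≤ T₀ (C y 0) := hmono (hy0.le.trans (hC0 y))
  have h3 : 4 * γ * ‖E4.spatial (C y)‖ ≤ 4 * γ * K :=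
    mul_le_mul_of_nonneg_left ((hCle y).trans hyK) (by positivity)
  have h4 := neg_abs_le (A y 0 - T₀ (C y 0))
  linarith

/-- **The truncated world-tubes of two holes are eventually disjoint.** [folklore] -/
theorem eventually_disjoint_truncLateRegion_images (𝓢 : Spacetime 4) {N : ℕ} (i j : Fin N)
    (M a : Fin N → ℝ) (ξ : Fin N → ℝ → E3) (U : Opens E4) (Φ : U → 𝓢.carrier) {τ₀ : ℝ}
    (hΦinj : InjOn Φ {x : U | τ₀ < x.1 0})
    (Λi Λj : lorentzGroup) {Ai Aj Ci Cj : E4 → E4} {Ti : ℝ → ℝ} {γ P : ℝ} (hγ : 0 ≤ γ) (hP : 0 ≤ P)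
    (hAiU : ∀ y ∈ boostedKerrExterior 1 0 (M i) (a i), Ai y ∈ U)
    (hAjU : ∀ y ∈ boostedKerrExterior 1 0 (M j) (a j), Aj y ∈ U)
    (hilate : ∀ y, τ₀ < Ai y 0) (hjlate : ∀ y, τ₀ < Aj y 0)
    (himono : Monotone Ti) (hiinf : Tendsto Ti atTop atTop)
    (hiwin : ∀ y, |Ai y 0 - Ti (Ci y 0)| ≤ 4 * γ * ‖E4.spatial (Ci y)‖)
    (hiCle : ∀ y, ‖E4.spatial (Ci y)‖ ≤ ‖E4.spatial y‖) (hjCle : ∀ y, ‖E4.spatial (Cj y)‖ ≤ ‖E4.spatial y‖)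
    (hiC0 : ∀ y, y 0 ≤ Ci y 0)
    (hioff : ∀ y, ‖E4.spatial (Ai y) - ξ i (Ai y 0)‖ ≤ P * ‖E4.spatial (Ci y)‖)
    (hjoff : ∀ y, ‖E4.spatial (Aj y) - ξ j (Aj y 0)‖ ≤ P * ‖E4.spatial (Cj y)‖)
    (hsep : Tendsto (fun t ↦ ‖ξ i t - ξ j t‖) atTop atTop) (R : ℝ) :
    ∀ᶠ τ₁ in atTop, Disjoint
      (boostChart Λi (M i) (a i) (fun y ↦ Φ ⟨Ai y.1, hAiU y.1 y.2⟩) ''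
        (boostedKerrBackground Λi 0 (M i) (a i)).truncLateRegion τ₁ R)
      (boostChart Λj (M j) (a j) (fun y ↦ Φ ⟨Aj y.1, hAjU y.1 y.2⟩) ''
        (boostedKerrBackground Λj 0 (M j) (a j)).truncLateRegion τ₁ R) := by
  set Ki : ℝ := max R 0 + |a i| with hKi
  set Kj : ℝ := max R 0 + |a j| with hKj
  -- separation after some lab time
  obtain ⟨S, hS⟩ := eventually_atTop.mp (hsep.eventually (eventually_gt_atTop (P * Ki + P * Kj)))
  -- the model time after which lab times are `≥ S`
  have hlate : ∀ᶠ τ₁ in atTop, S + 4 * γ * Ki ≤ Ti τ₁ := hiinf.eventually (eventually_ge_atTop _)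
  filter_upwards [hlate] with τ₁ hτ₁
  rw [Set.disjoint_left]
  rintro p ⟨xi, hxi, rfl⟩ ⟨xj, hxj, hpeq⟩
  -- the two model points
  have hxi' : (boostedKerrBackground Λi 0 (M i) (a i)).time xi.1 > τ₁ ∧
      (boostedKerrBackground Λi 0 (M i) (a i)).radius xi.1 ≤ R := hxi
  have hxj' : (boostedKerrBackground Λj 0 (M j) (a j)).time xj.1 > τ₁ ∧
      (boostedKerrBackground Λj 0 (M j) (a j)).radius xj.1 ≤ R := hxj
  clear hxi hxj
  obtain ⟨hxi1, hxi2⟩ := hxi'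
  obtain ⟨hxj1, hxj2⟩ := hxj'
  set yi : E4 := (Λi : E4 ≃L[ℝ] E4).symm xi.1 with hyi
  set yj : E4 := (Λj : E4 ≃L[ℝ] E4).symm xj.1 with hyj
  have hyi0 : τ₁ < yi 0 := by
    have h := hxi1; change τ₁ < (poincareInv Λi 0 xi.1) 0 at h; rwa [poincareInv, sub_zero] at h
  have hyj0 : τ₁ < yj 0 := by
    have h := hxj1; change τ₁ < (poincareInv Λj 0 xj.1) 0 at h; rwa [poincareInv, sub_zero] at h
  have hyiR : ‖E4.spatial yi‖ ≤ Ki := by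
    have h := hxi2; change Kerr.radius (a i) (poincareInv Λi 0 xi.1) ≤ R at h
    rw [poincareInv, sub_zero] at h
    exact norm_spatial_le_of_radius_le (a i) yi h
  have hyjR : ‖E4.spatial yj‖ ≤ Kj := by
    have h := hxj2; change Kerr.radius (a j) (poincareInv Λj 0 xj.1) ≤ R at h
    rw [poincareInv, sub_zero] at h
    exact norm_spatial_le_of_radius_le (a j) yj h
  -- the common lab point
  have hmemi : yi ∈ boostedKerrExterior 1 0 (M i) (a i) := symm_mem_boostedKerrExterior_one Λi (M i) (a i) xi.2
  have hmemj : yj ∈ boostedKerrExterior 1 0 (M j) (a j) := symm_mem_boostedKerrExterior_one Λj (M j) (a j) xj.2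
  have hΦeq : Φ ⟨Ai yi, hAiU yi hmemi⟩ = Φ ⟨Aj yj, hAjU yj hmemj⟩ := by
    have h1 : boostChart Λi (M i) (a i) (fun y ↦ Φ ⟨Ai y.1, hAiU y.1 y.2⟩) xi = Φ ⟨Ai yi, hAiU yi hmemi⟩ := rfl
    have h2 : boostChart Λj (M j) (a j) (fun y ↦ Φ ⟨Aj y.1, hAjU y.1 y.2⟩) xj = Φ ⟨Aj yj, hAjU yj hmemj⟩ := rfl
    rw [← h1, ← h2, hpeq]
  have hq : Ai yi = Aj yj := by
    have := hΦinj (show (⟨Ai yi, hAiU yi hmemi⟩ : U) ∈ {x : U | τ₀ < x.1 0} from hilate yi)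
      (show (⟨Aj yj, hAjU yj hmemj⟩ : U) ∈ {x : U | τ₀ < x.1 0} from hjlate yj) hΦeq
    exact congrArg Subtype.val this
  -- its lab time is late
  set t : ℝ := Ai yi 0 with ht
  have htS : S ≤ t := by
    have := labTime_ge_of_clauses himono hiwin hiCle hiC0 hγ hyi0 hyiR
    linarith
  -- both centres are close to the common point
  have h1 : ‖E4.spatial (Ai yi) - ξ i t‖ ≤ P * Ki :=
    (hioff yi).trans (mul_le_mul_of_nonneg_left ((hiCle yi).trans hyiR) hP)
  have h2 : ‖E4.spatial (Ai yi) - ξ j t‖ ≤ P * Kj := by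
    have h := hjoff yj
    rw [← hq] at h
    exact h.trans (mul_le_mul_of_nonneg_left ((hjCle yj).trans hyjR) hP)
  have h3 : ‖ξ i t - ξ j t‖ ≤ P * Ki + P * Kj := by
    have := norm_sub_le_norm_sub_add_norm_sub (ξ i t) (E4.spatial (Ai yi)) (ξ j t)
    rw [norm_sub_rev (ξ i t) (E4.spatial (Ai yi))] at this
    linarith
  have h4 := hS t htS
  linarith

/-- From pairwise eventual disjointness to a common time of pairwise disjointness (finitely many pairs).
[folklore] -/
theorem exists_pairwise_disjoint_of_eventually {X : Type*} {N : ℕ} (S : Fin N → ℝ → Set X)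
    (h : ∀ i j, i ≠ j → ∀ᶠ τ in atTop, Disjoint (S i τ) (S j τ)) :
    ∃ τ₁ : ℝ, Pairwise (Function.onFun Disjoint fun i ↦ S i τ₁) := by
  have hall : ∀ᶠ τ in atTop, ∀ p : Fin N × Fin N, p.1 ≠ p.2 → Disjoint (S p.1 τ) (S p.2 τ) := by
    refine eventually_all.mpr fun p ↦ ?_
    by_cases hp : p.1 = p.2
    · exact Eventually.of_forall fun τ hne ↦ (hne hp).elim
    · exact (h p.1 p.2 hp).mono fun τ hτ _ ↦ hτ
  obtain ⟨τ₁, hτ₁⟩ := hall.exists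
  exact ⟨τ₁, fun i j hij ↦ hτ₁ (i, j) hij⟩

/-- Registered one-line form (worker carrier `rechart_labTime_ge_of_clauses`). [folklore] -/
theorem rechart_labTime_ge_of_clauses : open Literature.Geometry.Lorentzian in ∀ {A C : E4 → E4} {T₀ : ℝ → ℝ} {γ K τ₁ : ℝ}, Monotone T₀ → (∀ y, |A y 0 - T₀ (C y 0)| ≤ 4 * γ * ‖E4.spatial (C y)‖) → (∀ y, ‖E4.spatial (C y)‖ ≤ ‖E4.spatial y‖) → (∀ y, y 0 ≤ C y 0) → 0 ≤ γ → ∀ {y : E4}, τ₁ < y 0 → ‖E4.spatial y‖ ≤ K → T₀ τ₁ - 4 * γ * K ≤ A y 0 :=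
  fun hmono hwin hCle hC0 hγ _ hy0 hyK ↦ labTime_ge_of_clauses hmono hwin hCle hC0 hγ hy0 hyK

end Summit.FinalStateConjecture.FinalStateConjecture.Theorems.SublinearIsFree.Rechart

end
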